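import Mathlib.GroupTheory.SpecificGroups.Cyclic
import Mathlib.GroupTheory.IndexNormal
import Literature.IUT.HodgeTheaters.PuncturedEllipticArrowModelIndices
import HarnessLib

/-!
# The finite model of [IUTchI] §1, part 4: normality, cyclic Galois groups, normalisers, the cusp laws (proof-only)

Mochizuki, *Inter-universal Teichmüller theory I*, kurims manuscript (May 2020), §1 pp. 37–40
([IUTchI] §1 p.38) [claim: Mochizuki2012, status: disputed] (D-0012 claim key; series status DISPUTED —
WITNESS-class, pure finite group theory over the model files of abc-iut-L5-t1; nothing of the series is
asserted, no side is taken on [IUTchIII] Cor. 3.12).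

In the model `Π_C = N ⋊ D_l`: `K, K′ ⊴ Π_C̲` ("open immersions [with normal image]", p. 38);
`Π_C̲/K′ ≅ ℤ/l` and `Π_C̲/K ≅ ℤ/2 × ℤ/l` are CYCLIC ("`Gal(C̲→/C̲) ≅ ℤ/lℤ`", "`Gal(X̲→/C̲) ≅ ℤ/2lℤ`"; the
second uses `2 ∤ l`); the NORMALISERS of `K` and `K′` in `Π_C` are exactly `Π_C̲` (Remark 1.2.1 p. 40:
"`Aut_k(X̲→) = Gal(X̲→/C̲)`, `Aut_k(C̲→) = Gal(C̲→/C̲)`" — a rotation `r_k`, `k ≠ 0`, moves the `B_{−k}` (or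
`B_2`) line out of `Ker ℓ`); and the eleven laws of the companion interface `CuspGalois` at the level of the
group (`D_l` acts on the cusps `ℤ/l` by `r_k : i ↦ i + k`, `s r_k : i ↦ −k − i`; conjugation moves `D_i` to
`D_{g·i}` on the nose; distinct cusps have distinct `D_i`; the rotations act simply transitively; `s` fixes
`0`, switches `±1`, inverts rotations; `2ε = 2 = r_1² · 0`).  PROOF-ONLY; symbolic `l`; axioms standard.
-/

namespace Literature.IUT.HodgeTheaters

namespace PuncturedEllipticData

namespace ArrowModel

open DihedralGroup
open scoped Pointwise

variable (l : ℕ)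

/-! ### Normality in `Π_C̲` -/

/-- `K′ ⊴ Π_C̲` (it is the kernel of `ellC`). ([IUTchI] §1 p.38) [claim: Mochizuki2012, status: disputed] -/
theorem normal_Khat'_subgroupOf_PiCbarm : ((Khat' l).subgroupOf (PiCbarm l)).Normal := by
  rw [← ker_ellC]; infer_instance

/-- `N ⊴ Π_C̲` (index `2`). ([IUTchI] §1 p.37) [claim: Mochizuki2012, status: disputed] -/
theorem normal_Nhat_subgroupOf_PiCbarm : ((Nhat l).subgroupOf (PiCbarm l)).Normal :=
  Subgroup.normal_of_index_eq_two (relIndex_Nhat_PiCbarm l)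

/-- `K ⊴ Π_C̲` (`K = N ∩ K′`). ([IUTchI] §1 p.38) [claim: Mochizuki2012, status: disputed] -/
theorem normal_Khat_subgroupOf_PiCbarm : ((Khat l).subgroupOf (PiCbarm l)).Normal := by
  have h : (Khat l).subgroupOf (PiCbarm l) =
      (Nhat l).subgroupOf (PiCbarm l) ⊓ (Khat' l).subgroupOf (PiCbarm l) := by
    ext g
    rw [Subgroup.mem_inf, Subgroup.mem_subgroupOf, Subgroup.mem_subgroupOf, Subgroup.mem_subgroupOf,
      ← Subgroup.mem_inf, Nhat_inf_Khat']
  haveI := normal_Nhat_subgroupOf_PiCbarm l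
  haveI := normal_Khat'_subgroupOf_PiCbarm l
  rw [h]; infer_instance

/-! ### The Galois groups `Π_C̲/K′ ≅ ℤ/l` and `Π_C̲/K ≅ ℤ/2 × ℤ/l` are cyclic -/

/-- **`Π_C̲/K′` is cyclic** (`≅ ℤ/l` via `ellC`). ([IUTchI] §1 p.38) [claim: Mochizuki2012, status: disputed] -/
theorem isCyclic_quot_Khat' (h2 : 2 ≤ l) : ∀ [((Khat' l).subgroupOf (PiCbarm l)).Normal],
    IsCyclic (PiCbarm l ⧸ (Khat' l).subgroupOf (PiCbarm l)) := by
  intro _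
  have e := (QuotientGroup.quotientKerEquivOfSurjective (ellC l) (ellC_surjective l h2)).symm.trans
    (QuotientGroup.quotientMulEquivOfEq (ker_ellC l))
  exact isCyclic_of_surjective e e.surjective

/-- `Ker(psiC) = K` (as a subgroup of `Π_C̲`). [claim: Mochizuki2012, status: disputed] -/
theorem ker_psiC : (psiC l).ker = (Khat l).subgroupOf (PiCbarm l) := by
  ext g
  rw [MonoidHom.mem_ker, psiC_apply, Prod.mk_eq_one, ofAdd_eq_one, ofAdd_eq_one, Subgroup.mem_subgroupOf,
    mem_Khat_iff]
  refine and_congr_left fun _ => ?_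
  rcases g.2 with h | h
  · rw [h, one_def, sgnIndex_r]; exact ⟨fun _ => rfl, fun _ => rfl⟩
  · rw [h, sgnIndex_sr]
    exact ⟨fun h' => absurd h' (by decide), fun h' => by cases h'⟩

/-- `psiC` is surjective. [claim: Mochizuki2012, status: disputed] -/
theorem psiC_surjective (h2 : 2 ≤ l) : Function.Surjective (psiC l) := by
  rintro ⟨a, m⟩
  obtain ⟨g, hg⟩ := ellC_surjective l h2 m
  have ha : Multiplicative.toAdd a = 0 ∨ Multiplicative.toAdd a = 1 := by
    generalize Multiplicative.toAdd a = b; revert b; decide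
  rcases ha with ha | ha
  · -- sign `0`: use an element of `N` with the right `ℓ`
    refine ⟨⟨inN l (0, Pi.single 0 (Multiplicative.toAdd m)), Nhat_le_PiCbarm l (inN_mem_Nhat l _)⟩, ?_⟩
    rw [psiC_apply, Prod.mk.injEq, inN_right, one_def, sgnIndex_r, inN_left, toAdd_ofAdd,
      ell_single_zero l h2, ofAdd_toAdd, ← ha, ofAdd_toAdd]
    exact ⟨rfl, rfl⟩
  · -- sign `1`: multiply by `ŝ`
    refine ⟨⟨inN l (0, Pi.single 0 (Multiplicative.toAdd m)) * sigmaHat l,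
      (PiCbarm l).mul_mem (Nhat_le_PiCbarm l (inN_mem_Nhat l _)) (sigmaHat_mem_PiCbarm l)⟩, ?_⟩
    rw [psiC_apply, Prod.mk.injEq, inN_mul_sigmaHat_right, sgnIndex_sr, inN_mul_sigmaHat_left, toAdd_ofAdd,
      ell_single_zero l h2, ofAdd_toAdd, ← ha, ofAdd_toAdd]
    exact ⟨rfl, rfl⟩

/-- **`Π_C̲/K` is cyclic** (`≅ ℤ/2 × ℤ/l` via `psiC`, cyclic as `2 ∤ l`). ([IUTchI] §1 p.38)
[claim: Mochizuki2012, status: disputed] -/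
theorem isCyclic_quot_Khat [NeZero l] (h2 : 2 ≤ l) (hodd : Odd l) : ∀ [((Khat l).subgroupOf (PiCbarm l)).Normal],
    IsCyclic (PiCbarm l ⧸ (Khat l).subgroupOf (PiCbarm l)) := by
  intro _
  haveI : IsCyclic (Multiplicative (ZMod 2) × Multiplicative (ZMod l)) := by
    rw [Group.isCyclic_prod_iff]
    refine ⟨inferInstance, inferInstance, ?_⟩
    rw [Nat.card_eq_fintype_card, Fintype.card_multiplicative, ZMod.card, card_multiplicative_zmod]
    exact (Nat.coprime_two_left).mpr hodd
  have e := (QuotientGroup.quotientKerEquivOfSurjective (psiC l) (psiC_surjective l h2)).symm.trans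
    (QuotientGroup.quotientMulEquivOfEq (ker_psiC l))
  exact isCyclic_of_surjective e e.surjective

/-! ### Normalisers: `N_{Π_C}(K) = N_{Π_C}(K′) = Π_C̲` (Remark 1.2.1) -/

/-- Conjugation by `Π_C̲` preserves `K′`. [claim: Mochizuki2012, status: disputed] -/
theorem conj_mem_Khat' {g n : G l} (hg : g ∈ PiCbarm l) (hn : n ∈ Khat' l) : g * n * g⁻¹ ∈ Khat' l := by
  have h := (normal_Khat'_subgroupOf_PiCbarm l).conj_mem ⟨n, Khat'_le_PiCbarm l hn⟩
    (Subgroup.mem_subgroupOf.mpr hn) ⟨g, hg⟩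
  exact Subgroup.mem_subgroupOf.mp h

/-- Conjugation by `Π_C̲` preserves `K`. [claim: Mochizuki2012, status: disputed] -/
theorem conj_mem_Khat {g n : G l} (hg : g ∈ PiCbarm l) (hn : n ∈ Khat l) : g * n * g⁻¹ ∈ Khat l := by
  have h := (normal_Khat_subgroupOf_PiCbarm l).conj_mem ⟨n, Nhat_le_PiCbarm l (Khat_le_Nhat l hn)⟩
    (Subgroup.mem_subgroupOf.mpr hn) ⟨g, hg⟩
  exact Subgroup.mem_subgroupOf.mp h

/-- The `Δ_ε⁺`-coordinate of a moved basis line: `ℓ(φ_d(0, δ_a)) = δ_a(−k) − δ_a(1−k)` where `k` is the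
rotation index of `d` (for both `r_k` and `s r_k`). [claim: Mochizuki2012, status: disputed] -/
theorem ell_dact_single (d : DihedralGroup l) (a : ZMod l) :
    ell l (dact l d (0, δ l a)) = δ l a (-rotIndex l d) - δ l a (1 - rotIndex l d) := by
  cases d with
  | r k =>
    rw [rotIndex_r, dact_r]
    show δ l a (0 - k) - δ l a (1 - k) = _
    rw [zero_sub]
  | sr k =>
    show -δ l a (1 - k - 0) - -δ l a (1 - k - 1) = δ l a (-k) - δ l a (1 - k)
    rw [sub_zero, sub_sub_cancel_left]; ring

/-- KEY for Remark 1.2.1: an element of `Π_C` OUTSIDE `Π_C̲` (rotation index `k ≠ 0`) conjugates some element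
of `K` out of `K′` (witness: the line `B_{−k}`, or `B_2` when `k = −1`). ([IUTchI] Rmk 1.2.1 p.40)
[claim: Mochizuki2012, status: disputed] -/
theorem exists_conj_not_mem (h3 : 3 ≤ l) {g : G l} (hg : g ∉ PiCbarm l) :
    ∃ n ∈ Khat l, g * n * g⁻¹ ∉ Khat' l := by
  have h10 : (1 : ZMod l) ≠ 0 := by exact_mod_cast natCast_ne_zero_of_lt l (a := 1) one_pos (by omega)
  have h20 : (2 : ZMod l) ≠ 0 := by exact_mod_cast natCast_ne_zero_of_lt l (a := 2) two_pos (by omega)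
  -- the rotation index `k` of `g.right` is nonzero
  set k := rotIndex l g.right with hk
  have hk0 : k ≠ 0 := by
    intro h0
    apply hg
    rcases hd : g.right with j | j <;> rw [hd] at hk <;> simp only [rotIndex] at hk
    · exact Or.inl (by rw [hd, ← hk, h0, r_zero])
    · exact Or.inr (by rw [hd, ← hk, h0])
  -- choose the witness line `a ∉ {0, 1}` with `δ_a(−k) − δ_a(1−k) ≠ 0`
  obtain ⟨a, ha0, ha1, hval⟩ : ∃ a : ZMod l, a ≠ 0 ∧ a ≠ 1 ∧ δ l a (-k) - δ l a (1 - k) ≠ 0 := by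
    by_cases hk1 : k = -1
    · refine ⟨2, h20, fun h => h10 (by linear_combination h), ?_⟩
      have e1 : -k ≠ (2 : ZMod l) := by rw [hk1, neg_neg]; exact fun h => h10 (by linear_combination -h)
      have e2 : 1 - k = (2 : ZMod l) := by rw [hk1]; ring
      rw [δ_ne l e1, e2, δ_same]; exact fun h => h10 (by linear_combination -h)
    · refine ⟨-k, neg_ne_zero.mpr hk0, fun h => hk1 (by linear_combination -h), ?_⟩
      have e2 : 1 - k ≠ -k := fun h => h10 (by linear_combination h)
      rw [δ_same, δ_ne l e2]; exact fun h => h10 (by linear_combination h)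
  refine ⟨inN l (0, δ l a), (inN_mem_Khat_iff l _).mpr ?_, ?_⟩
  · change δ l a 0 - δ l a 1 = 0
    rw [δ_ne l ha0.symm, δ_ne l ha1.symm, sub_self]
  · rw [conj_inN, mem_Khat'_iff, inN_right, inN_left, toAdd_ofAdd, ell_dact_single]
    exact fun h => hval h.2

/-- **`N_{Π_C}(K) = Π_C̲`** (Remark 1.2.1: `Aut_k(X̲→) = Gal(X̲→/C̲)`). ([IUTchI] Rmk 1.2.1 p.40)
[claim: Mochizuki2012, status: disputed] -/
theorem normalizer_Khat (h3 : 3 ≤ l) : Subgroup.normalizer (Khat l : Set (G l)) = PiCbarm l := by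
  ext g
  rw [Subgroup.mem_set_normalizer_iff]
  constructor
  · intro h
    by_contra hg
    obtain ⟨n, hn, hno⟩ := exists_conj_not_mem l h3 hg
    exact hno (Khat_le_Khat' l ((h n).mp hn))
  · intro hg n
    simp only [SetLike.mem_coe]
    refine ⟨conj_mem_Khat l hg, fun h => ?_⟩
    have h' := conj_mem_Khat l ((PiCbarm l).inv_mem hg) h
    rwa [inv_inv, ← mul_assoc, ← mul_assoc, inv_mul_cancel, one_mul, inv_mul_cancel_right] at h'

/-- **`N_{Π_C}(K′) = Π_C̲`** (Remark 1.2.1: `Aut_k(C̲→) = Gal(C̲→/C̲)`). ([IUTchI] Rmk 1.2.1 p.40)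
[claim: Mochizuki2012, status: disputed] -/
theorem normalizer_Khat' (h3 : 3 ≤ l) : Subgroup.normalizer (Khat' l : Set (G l)) = PiCbarm l := by
  ext g
  rw [Subgroup.mem_set_normalizer_iff]
  constructor
  · intro h
    by_contra hg
    obtain ⟨n, hn, hno⟩ := exists_conj_not_mem l h3 hg
    exact hno ((h n).mp (Khat_le_Khat' l hn))
  · intro hg n
    simp only [SetLike.mem_coe]
    refine ⟨conj_mem_Khat' l hg, fun h => ?_⟩
    have h' := conj_mem_Khat' l ((PiCbarm l).inv_mem hg) h
    rwa [inv_inv, ← mul_assoc, ← mul_assoc, inv_mul_cancel, one_mul, inv_mul_cancel_right] at h'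

/-! ### The laws of `CuspGalois` at the level of `N ⋊ D_l` -/

/-- `(inN)` is injective. [claim: Mochizuki2012, status: disputed] -/
theorem inN_injective : Function.Injective (inN l) := fun v w h => by
  have h' := congrArg SemidirectProduct.left h
  rwa [inN_left, inN_left, Multiplicative.ofAdd.injective.eq_iff] at h'

/-- Distinct cusps have distinct decomposition groups: `D_i = D_j → i = j` (the support `{i, i+1}` of `c_i`).
([IUTchI] §1 p.37) [claim: Mochizuki2012, status: disputed] -/
theorem Dm_injective (h3 : 3 ≤ l) : Function.Injective (Dm l) := by
  have h10 : (1 : ZMod l) ≠ 0 := by exact_mod_cast natCast_ne_zero_of_lt l (a := 1) one_pos (by omega)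
  have h20 : (2 : ZMod l) ≠ 0 := by exact_mod_cast natCast_ne_zero_of_lt l (a := 2) two_pos (by omega)
  intro i j hij
  have hmem : chat l i ∈ Dm l j := hij ▸ Subgroup.mem_zpowers _
  obtain ⟨t, ht⟩ := Subgroup.mem_zpowers_iff.mp hmem
  unfold chat at ht
  rw [← inN_zsmul] at ht
  have hv := congrArg Prod.snd (inN_injective l ht)
  rw [Prod.smul_snd] at hv
  simp only [cvec] at hv
  -- evaluate `t • c_j = c_i` at `i + 1` and at `i`
  have e1 := congrFun hv (i + 1)
  have e2 := congrFun hv i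
  simp only [Pi.smul_apply, Pi.sub_apply, zsmul_eq_mul] at e1 e2
  rw [δ_same, δ_ne l (show i + 1 ≠ i from fun h => h10 (by linear_combination h))] at e1
  rw [δ_ne l (show i ≠ i + 1 from fun h => h10 (by linear_combination -h)), δ_same] at e2
  by_contra hne
  by_cases hij1 : i = j + 1
  · -- then at `i + 1 = j + 2`: `δ_{j+1}(j+2) = 0`, `δ_j(j+2) = 0`
    rw [hij1] at e1
    rw [δ_ne l (show j + 1 + 1 ≠ j + 1 from fun h => h10 (by linear_combination h)),
      δ_ne l (show j + 1 + 1 ≠ j from fun h => h20 (by linear_combination h))] at e1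
    exact h10 (by linear_combination -e1)
  · rw [δ_ne l hij1, δ_ne l hne] at e2
    exact h10 (by linear_combination e2)

/-- `act_decomp` in the model, on the nose (`t = 1`). ([IUTchI] §1 p.37) [claim: Mochizuki2012, status: disputed] -/
theorem act_decomp_aux (g : G l) (i : ZMod l) :
    ∃ t ∈ PiXm l ⊓ PiCbarm l, MulAut.conj (t * g) • Dm l i = Dm l (actm l g i) :=
  ⟨1, Subgroup.one_mem _, by rw [one_mul, conj_smul_Dm, actm_apply]⟩

/-- `eq_of_conj` in the model. ([IUTchI] §1 p.37) [claim: Mochizuki2012, status: disputed] -/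
theorem eq_of_conj_aux (h3 : 3 ≤ l) (i j : ZMod l) (t : G l) (ht : t ∈ PiXm l ⊓ PiCbarm l)
    (h : MulAut.conj t • Dm l i = Dm l j) : i = j := by
  rw [PiXm_inf_PiCbarm, mem_Nhat_iff] at ht
  rw [conj_smul_Dm, ht, one_def, cuspAct_r, add_zero] at h
  exact Dm_injective l h3 h

/-- `free` in the model: a rotation fixing a cusp is trivial. ([IUTchI] §1 p.37) [claim: Mochizuki2012, status: disputed] -/
theorem free_aux (g : G l) (hg : g ∈ PiXm l) (i : ZMod l) (h : actm l g i = i) : g ∈ PiXm l ⊓ PiCbarm l := by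
  obtain ⟨k, hk⟩ := hg
  rw [actm_apply, hk, cuspAct_r, add_eq_left] at h
  rw [PiXm_inf_PiCbarm, mem_Nhat_iff, hk, h, r_zero]

/-- `transitive` in the model. ([IUTchI] §1 p.37) [claim: Mochizuki2012, status: disputed] -/
theorem transitive_aux (i j : ZMod l) : ∃ g ∈ PiXm l, actm l g i = j :=
  ⟨SemidirectProduct.inr (r (j - i)), ⟨j - i, rfl⟩, by rw [actm_apply]; exact add_sub_cancel i j⟩

/-- `exists_generator` in the model: `(0, r_1)` generates the image of `Π_X`. ([IUTchI] §1 p.37)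
[claim: Mochizuki2012, status: disputed] -/
theorem generator_aux [NeZero l] : ∃ g ∈ PiXm l, ∀ h ∈ PiXm l, ∃ n : ℤ, actm l h = actm l g ^ n := by
  refine ⟨SemidirectProduct.inr (r 1), ⟨1, rfl⟩, ?_⟩
  rintro h ⟨k, hk⟩
  refine ⟨(k.val : ℤ), ?_⟩
  rw [zpow_natCast, ← map_pow]
  refine Equiv.ext fun i => ?_
  have hr : ((SemidirectProduct.inr (r 1) : G l) ^ k.val).right = r k := by
    rw [← map_pow, SemidirectProduct.right_inr, r_one_pow, ZMod.natCast_zmod_val]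
  rw [actm_apply, actm_apply, hk, hr]

/-- `conj_mul_mem_PiXbar` in the model: `s r_k s r_k = 1`. ([IUTchI] §1 p.37) [claim: Mochizuki2012, status: disputed] -/
theorem conj_aux (c : G l) (hc : c ∈ PiCbarm l) (hcX : c ∉ PiXm l) (g : G l) (hg : g ∈ PiXm l) :
    c * g * c⁻¹ * g ∈ PiXm l ⊓ PiCbarm l := by
  obtain ⟨k, hk⟩ := hg
  rw [PiXm_inf_PiCbarm, mem_Nhat_iff, SemidirectProduct.mul_right, SemidirectProduct.mul_right,
    SemidirectProduct.mul_right, SemidirectProduct.inv_right, right_eq_sr_of_mem_PiCbarm l hc hcX, hk, inv_sr,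
    sr_mul_r, sr_mul_sr, r_mul_r, zero_add, zero_sub, neg_add_cancel, r_zero]

/-- `act_ε0` in the model: `Π_C̲` fixes the cusp `0`. ([IUTchI] §1 p.37) [claim: Mochizuki2012, status: disputed] -/
theorem act0_aux (c : G l) (hc : c ∈ PiCbarm l) : actm l c 0 = 0 := by
  rcases hc with hc | hc
  · rw [actm_apply, hc, one_def, cuspAct_r, add_zero]
  · rw [actm_apply, hc, cuspAct_sr, neg_zero, sub_zero]

/-- `act_ε1` in the model: `s` switches `±1`. ([IUTchI] §1 p.37) [claim: Mochizuki2012, status: disputed] -/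
theorem act1_aux (c : G l) (hc : c ∈ PiCbarm l) (hcX : c ∉ PiXm l) : actm l c 1 = -1 := by
  rw [actm_apply, right_eq_sr_of_mem_PiCbarm l hc hcX, cuspAct_sr, neg_zero, zero_sub]

/-- `act_twoε` in the model: `2 = r_1² · 0`. ([IUTchI] §1 p.38) [claim: Mochizuki2012, status: disputed] -/
theorem act2_aux (g : G l) (hg : g ∈ PiXm l) (h : actm l g 0 = 1) :
    actm l (g * g) 0 = 2 ∨ actm l (g⁻¹ * g⁻¹) 0 = 2 := by
  obtain ⟨k, hk⟩ := hg
  left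
  rw [actm_apply, hk, cuspAct_r, zero_add] at h
  rw [actm_apply, SemidirectProduct.mul_right, hk, r_mul_r, cuspAct_r, zero_add, h]
  norm_num

/-! ### The Def. 3.1 (d) numerics at the level of `N ⋊ D_l` -/

/-- `[Π_X : Π_X ∩ Π_C̲] = l`. ([IUTchI] Def 3.1(d) p.62) [claim: Mochizuki2012, status: disputed] -/
theorem relIndex_inf_PiXm [NeZero l] : (PiXm l ⊓ PiCbarm l).relIndex (PiXm l) = l := by
  rw [PiXm_inf_PiCbarm, relIndex_Nhat_PiXm]

/-- `[Π_C̲ : Π_X ∩ Π_C̲] = 2`. ([IUTchI] Def 3.1(d) p.62) [claim: Mochizuki2012, status: disputed] -/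
theorem relIndex_inf_PiCbarm : (PiXm l ⊓ PiCbarm l).relIndex (PiCbarm l) = 2 := by
  rw [PiXm_inf_PiCbarm, relIndex_Nhat_PiCbarm]

/-- `Π_C̲ ⊄ Π_X` (`ŝ ∈ Π_C̲ ∖ Π_X`). ([IUTchI] Def 3.1(d) p.62) [claim: Mochizuki2012, status: disputed] -/
theorem not_PiCbarm_le_PiXm : ¬ PiCbarm l ≤ PiXm l := fun h =>
  sigmaHat_not_mem_PiXm l (h (sigmaHat_mem_PiCbarm l))

/-! ### `N` is elementary abelian of exponent `l` (for `modLKer = 1`) -/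

/-- `N` is abelian: `⁅N, N⁆ = 1`. [claim: Mochizuki2012, status: disputed] -/
theorem commutator_Nhat_eq_bot : ⁅Nhat l, Nhat l⁆ = ⊥ := by
  rw [Subgroup.commutator_eq_bot_iff_le_centralizer]
  intro g hg
  rw [Subgroup.mem_centralizer_iff]
  intro h hh
  rw [eq_inN_of_right_eq_one l ((mem_Nhat_iff l g).mp hg), eq_inN_of_right_eq_one l ((mem_Nhat_iff l h).mp hh),
    ← inN_add, ← inN_add, add_comm]

/-- `N` has exponent `l`: the `l`-th powers of `N` are trivial. [claim: Mochizuki2012, status: disputed] -/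
theorem closure_pow_Nhat_eq_bot : Subgroup.closure ((fun y : G l => y ^ l) '' (Nhat l : Set (G l))) = ⊥ := by
  rw [Subgroup.closure_eq_bot_iff]
  rintro y ⟨g, hg, rfl⟩
  rw [Set.mem_singleton_iff]
  show g ^ l = 1
  rw [eq_inN_of_right_eq_one l ((mem_Nhat_iff l g).mp hg), ← inN_nsmul, l_nsmul_eq_zero, inN_zero]

end ArrowModel

end PuncturedEllipticData

end Literature.IUT.HodgeTheaters
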